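import Literature.MathematicalPhysics.QuantumFieldTheory.Balaban1983to89.T4BetaMemorySharp
import Summits.QuantumFields.BalabanUV.T4Continuum.Spine.NE4.Targets

/-!
# Spine/NE4/AsymptoticContent — what NE4 (`ScaleShiftRate`) does and does not contain: (§1) NOTHING at finitely many scales —
# every finite prefix of NE4 follows from the printed-type uniform bound alone (finite-scale vacuity); (§2) ALL of the β⁰-half's
# conclusion (AF-0r) — NE4 for the full β ⟹ the one-loop coefficients are geometrically Cauchy, so NE4 ⟺ (AF-0r) ∧ β¹-rate

Cell `pub-balaban-gaps` (YM blitz G2), seat `ne4` (unit `pub-balaban-gaps-ne4-g4`), record `HOME/ne/NE4.md` §5 census items (R31) and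
(R32).  Sibling of `Spine/NE4/Targets` (NE4 on the data), `Spine/NE4/Necessity`, `Spine/NE4/FadingFromRate{,Under,Sharp}` and of the NE9
seat's `Spine/NE9/FiniteScaleVacuity` (the same question for row NE9).

WHY (two census questions of row NE4, settled in the kernel).

(§1) «Can a FINITE computation bear on NE4?»  Row NE4's one data item is the numerical η-sequence of the one-loop coefficient
`β⁰_{k+1}` for `k ≤ 2` (census (R25), compute ask CA-1).  `ScaleShiftRate c θ γ β` quantifies over ALL scales `k`; but on any finite
prefix `k ≤ k₀` the inequality `|β_{k+2}(w) − β_{k+1}(Fin.tail w)| ≤ c·θ^k` already follows from the PRINTED-TYPE uniform bound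
`|β_{k+1}| ≤ B` ([Balaban1987RG1] p. 264 «uniformly bounded on this interval»; tree `FlowStep.BetaUpperH` / its lower twin) with
`c = 2B/θ^{k₀}` (`shift_prefix_of_bound`), and «NE4 from some scale `k₀` on» is the same as NE4 with a worse constant
(`scaleShiftRate_of_eventually`).  So NE4's content is purely ASYMPTOTIC — the `k`-uniformity of ONE constant —, exactly as print phrases
UV stability ([Balaban1987RG1] p. 259 «the above bound is uniform in the lattice spacing ε»); no table of finitely many `β_{k+1}` can refute
or certify it; a finite computation calibrates the constant at a presumed rate, nothing more.  (This is the NE4 twin of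
`Spine/NE9/FiniteScaleVacuity.ne9_and_fadingMemory_of_boundedScales`.)

(§2) «Is the β⁰-half avoidable — could NE4 be cheaper than the live crux (AF-0r) = GAPS G-an2-4?»  NO: for the PRINTED one-loop split
`β_{k+1} = β⁰_{k+1} + β¹_{k+1}(g_0,…,g_k)` ([Balaban1987RG1] (2.12)–(2.14) p. 268, tree `B12Beta.OneLoopSplit`) with the remainder bounded at
the corner by `|β¹_{k+1}(p)| ≤ C·g_k` (the (AF-1) shape `B12Beta.af1_of_vanish_lipschitz` produces from the printed vanishing at `g_k = 0`,
(2.13) p. 268 «the expression under the exponential above vanishes at g_k = 0», plus the p. 264 derivative clause), NE4 for the FULL β forces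
`|β⁰_{k+2} − β⁰_{k+1}| ≤ c·θ^k` (`abs_beta0_step_le_of_scaleShiftRate`: evaluate NE4 on the constant histories `(t,…,t)` and let `t → 0⁺`),
hence a limit `β⁰_∞` with `|β⁰_{k+1} − β⁰_∞| ≤ (c/(1−θ))·θ^k` (`conv_of_scaleShiftRate`, geometric Cauchy) — i.e. EXACTLY the `hconv` input
of `FlowStepRuns` §10 / the field `conv` of `Beta.Assembly.LimitForm` that row G-an2-4 exists to supply.  With the tree's two bookkeeping
directions (`T4CouplingMatching.scaleShiftRate_of_split`: (AF-0r) ∧ β¹-rate ⟹ NE4; `T4BetaMemorySharp.remainderShiftRate_of_scaleShiftRate`: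
NE4 ∧ (AF-0r) ⟹ β¹-rate) the square closes: `scaleShiftRate_iff_split` — at a fixed rate `θ`, NE4 for the full β ⟺ (AF-0r) ∧
`RemainderShiftRate`, under the corner bound.  CONSEQUENCE FOR THE ROW (bookkeeping, no status word moves): the dependency edge NE4 — G-an2-4
is two-way; any road to NE4 re-proves (AF-0r)'s conclusion; NE4 ≡ (AF-0r) + «NE5 on the β-carrier» with nothing else hidden.

WHAT THIS FILE IS NOT.  Not an estimate: `ScaleShiftRate` / `NE4OnData` / the uniform bound / the corner bound are BINDERS in every
theorem; nothing of Bałaban's is asserted; no `def … : Prop` is minted (0 definitions).  HONEST FRAMING: NE4 is NOT IN PRINT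
([Balaban1987RG1] p. 264 «We will investigate other properties in a separate paper»; cell GAPS G-t4-U2-1 and G-t4-U2-2), NOT PROVED, booked DEPENDENT
= (R)∘{NE5} + (AF-0r); spine PROVED 0/9 unchanged; one finite T⁴ — NOT continuum on ℝ⁴, NOT infinite volume, NOT a mass gap, NOT Clay.
0 sorry; axioms standard; imports one Literature module and `Spine/NE4/Targets`, modifies nothing.  Elementary real analysis, `[folklore]`.

References (locators only): [Balaban1987RG1] = T. Bałaban, CMP **109** (1987) 249–301: (0.20) p. 256, Thm 2 p. 259, p. 264, (2.12)–(2.14)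
p. 268, p. 298.
-/

namespace Summit.QuantumFields.BalabanUV.T4Continuum.Spine.NE4

open Literature.MathematicalPhysics.QuantumFieldTheory.Balaban1983to89
open Literature.MathematicalPhysics.QuantumFieldTheory.Balaban1983to89.FlowStep
open Literature.MathematicalPhysics.QuantumFieldTheory.Balaban1983to89.T4CouplingMatching
  (ScaleShiftRate RemainderShiftRate scaleShiftRate_of_split)
open Literature.MathematicalPhysics.QuantumFieldTheory.Balaban1983to89.T4Continuum
open Filter Topology

/-! ## §1 Finite-scale vacuity: any finite prefix of NE4 is free under the uniform bound -/

section Prefix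

variable {β : HBeta} {B γ θ c : ℝ}

/-- [bookkeeping] Under the printed-type uniform bound `|β_{k+1}| ≤ B` on the boxes, the scale shift of NE4 is trivially `≤ 2B` at
EVERY scale (triangle inequality; `Fin.tail` keeps the history in the box). [folklore] -/
theorem abs_shift_le_two_bound (hB : ∀ k (v : Fin (k + 1) → ℝ), v ∈ Box γ k → |β k v| ≤ B)
    {k : ℕ} {w : Fin (k + 2) → ℝ} (hw : w ∈ Box γ (k + 1)) :
    |β (k + 1) w - β k (Fin.tail w)| ≤ 2 * B := by
  have h1 := hB (k + 1) w hw
  have h2 := hB k (Fin.tail w) (T4FlagMemory.tail_mem_box hw)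
  calc |β (k + 1) w - β k (Fin.tail w)| ≤ |β (k + 1) w| + |β k (Fin.tail w)| := abs_sub _ _
    _ ≤ B + B := add_le_add h1 h2
    _ = 2 * B := by ring

/-- **FINITE-SCALE VACUITY OF NE4.**  For every `k₀` and every rate `θ ∈ ]0, 1]`, the NE4 inequality
`|β_{k+2}(w) − β_{k+1}(Fin.tail w)| ≤ c·θ^k` holds on the whole finite prefix `k ≤ k₀` with `c = 2B/θ^{k₀}`, from the uniform bound
ALONE.  Hence no finite table of β-functions (e.g. the one-loop η-sequence `β⁰_{k+1}`, `k ≤ 2`, of the row's compute ask) can refute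
or certify NE4: its content is the `k`-UNIFORMITY of one constant. [folklore] -/
theorem shift_prefix_of_bound (hB : ∀ k (v : Fin (k + 1) → ℝ), v ∈ Box γ k → |β k v| ≤ B)
    (hθ0 : 0 < θ) (hθ1 : θ ≤ 1) (k₀ : ℕ) :
    ∀ k, k ≤ k₀ → ∀ w : Fin (k + 2) → ℝ, w ∈ Box γ (k + 1) →
      |β (k + 1) w - β k (Fin.tail w)| ≤ (2 * B / θ ^ k₀) * θ ^ k := by
  intro k hk w hw
  have hθk₀ : 0 < θ ^ k₀ := pow_pos hθ0 k₀
  have hmono : θ ^ k₀ ≤ θ ^ k := pow_le_pow_of_le_one hθ0.le hθ1 hk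
  have h2B : |β (k + 1) w - β k (Fin.tail w)| ≤ 2 * B := abs_shift_le_two_bound hB hw
  have hBnn : 0 ≤ 2 * B := (abs_nonneg _).trans h2B
  calc |β (k + 1) w - β k (Fin.tail w)| ≤ 2 * B := h2B
    _ = (2 * B / θ ^ k₀) * θ ^ k₀ := by rw [div_mul_cancel₀ _ (ne_of_gt hθk₀)]
    _ ≤ (2 * B / θ ^ k₀) * θ ^ k := mul_le_mul_of_nonneg_left hmono (div_nonneg hBnn hθk₀.le)

/-- **EVENTUALLY-NE4 IS NE4.**  If the NE4 inequality holds with constant `c` from some scale `k₀` on, and `|β_{k+1}| ≤ B` on the boxes,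
then `ScaleShiftRate (max c (2B/θ^{k₀})) θ γ β` — NE4 proper with a worse constant.  NE4 is an ASYMPTOTIC statement; its finite
prefixes carry no information beyond the printed-type bound. [folklore] -/
theorem scaleShiftRate_of_eventually (hB : ∀ k (v : Fin (k + 1) → ℝ), v ∈ Box γ k → |β k v| ≤ B)
    (hθ0 : 0 < θ) (hθ1 : θ ≤ 1) {k₀ : ℕ}
    (hev : ∀ k, k₀ ≤ k → ∀ w : Fin (k + 2) → ℝ, w ∈ Box γ (k + 1) →
      |β (k + 1) w - β k (Fin.tail w)| ≤ c * θ ^ k) :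
    ScaleShiftRate (max c (2 * B / θ ^ k₀)) θ γ β := by
  intro k w hw
  have hθk : 0 ≤ θ ^ k := pow_nonneg hθ0.le k
  rcases le_or_gt k₀ k with hk | hk
  · exact (hev k hk w hw).trans (mul_le_mul_of_nonneg_right (le_max_left _ _) hθk)
  · exact (shift_prefix_of_bound hB hθ0 hθ1 k₀ k hk.le w hw).trans
      (mul_le_mul_of_nonneg_right (le_max_right _ _) hθk)

end Prefix

/-! ## §2 The corner: NE4 for the full β contains (AF-0r) — the square NE4 ⟺ (AF-0r) ∧ β¹-rate -/

section Corner

variable {β : HBeta} (S : B12Beta.OneLoopSplit β) {C c γ θ : ℝ}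

/-- [bookkeeping] The constant of `ScaleShiftRate` is non-negative as soon as the box is non-empty (evaluate at `k = 0` on the
constant history `γ`); re-derived here in three lines (the tree has it as `T4BetaStationary.constant_nonneg_of_scaleShiftRate`, not
imported). [folklore] -/
theorem scaleShiftRate_const_nonneg (h : ScaleShiftRate c θ γ β) (hγ : 0 < γ) : 0 ≤ c := by
  have hw : (fun _ : Fin (0 + 2) => γ) ∈ Box γ (0 + 1) := mem_box.mpr fun _ => ⟨hγ, le_rfl⟩
  have := (abs_nonneg _).trans (h 0 _ hw)
  simpa using this

/-- **CORNER LEMMA — NE4 for the full β bounds the one-loop step.**  For the printed one-loop split `S` ((2.12)–(2.14) p. 268) with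
the remainder bounded at the corner by `|β¹_{k+1}(p)| ≤ C·g_k` on the boxes (shape (AF-1), `B12Beta.af1_of_vanish_lipschitz`),
`ScaleShiftRate c θ γ β` gives `|β⁰_{k+2} − β⁰_{k+1}| ≤ c·θ^k` for every `k`: evaluate NE4 on the constant history `(t, …, t)`,
`t ∈ ]0, γ]`, subtract the two remainders (each `≤ |C|·t`), and let `t → 0⁺`. [cite: Balaban1987RG1, (2.12)-(2.14) p.268] -/
theorem abs_beta0_step_le_of_scaleShiftRate (hγ : 0 < γ)
    (hC : ∀ k (p : Fin (k + 1) → ℝ), p ∈ Box γ k → |S.β1 k p| ≤ C * p (Fin.last k))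
    (h : ScaleShiftRate c θ γ β) (k : ℕ) : |S.β0 (k + 1) - S.β0 k| ≤ c * θ ^ k := by
  refine le_of_forall_pos_le_add fun ε hε => ?_
  have hden : 0 < 2 * |C| + 1 := by positivity
  obtain ⟨t, ht0, htγ, htε⟩ : ∃ t : ℝ, 0 < t ∧ t ≤ γ ∧ t ≤ ε / (2 * |C| + 1) :=
    ⟨min γ (ε / (2 * |C| + 1)), lt_min hγ (div_pos hε hden), min_le_left _ _, min_le_right _ _⟩
  let w : Fin (k + 2) → ℝ := fun _ => t
  have hw : w ∈ Box γ (k + 1) := mem_box.mpr fun _ => ⟨ht0, htγ⟩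
  have hw' : Fin.tail w ∈ Box γ k := mem_box.mpr fun _ => ⟨ht0, htγ⟩
  have h1 : |β (k + 1) w - β k (Fin.tail w)| ≤ c * θ ^ k := h k w hw
  have h2 : |S.β1 (k + 1) w| ≤ C * t := hC (k + 1) w hw
  have h3 : |S.β1 k (Fin.tail w)| ≤ C * t := hC k (Fin.tail w) hw'
  have hCt : C * t ≤ |C| * t := mul_le_mul_of_nonneg_right (le_abs_self C) ht0.le
  have hsmall : |C| * t + |C| * t ≤ ε := by
    have h4 : 2 * |C| * t ≤ 2 * |C| * (ε / (2 * |C| + 1)) :=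
      mul_le_mul_of_nonneg_left htε (by positivity)
    have h5 : 2 * |C| * (ε / (2 * |C| + 1)) ≤ (2 * |C| + 1) * (ε / (2 * |C| + 1)) :=
      mul_le_mul_of_nonneg_right (by linarith) (div_nonneg hε.le hden.le)
    have h6 : (2 * |C| + 1) * (ε / (2 * |C| + 1)) = ε := by field_simp
    linarith
  have e : S.β0 (k + 1) - S.β0 k
      = (β (k + 1) w - β k (Fin.tail w)) - (S.β1 (k + 1) w - S.β1 k (Fin.tail w)) := by
    rw [S.split (k + 1) w, S.split k (Fin.tail w)]; ring
  rw [e]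
  calc |(β (k + 1) w - β k (Fin.tail w)) - (S.β1 (k + 1) w - S.β1 k (Fin.tail w))|
      ≤ |β (k + 1) w - β k (Fin.tail w)| + |S.β1 (k + 1) w - S.β1 k (Fin.tail w)| := abs_sub _ _
    _ ≤ c * θ ^ k + (|S.β1 (k + 1) w| + |S.β1 k (Fin.tail w)|) := add_le_add h1 (abs_sub _ _)
    _ ≤ c * θ ^ k + (|C| * t + |C| * t) := add_le_add le_rfl (add_le_add (h2.trans hCt) (h3.trans hCt))
    _ ≤ c * θ ^ k + ε := add_le_add le_rfl hsmall

/-- **NE4 for the full β ⟹ (AF-0r).**  Under the corner bound and `θ < 1`, `ScaleShiftRate c θ γ β` yields a limit `β⁰_∞` of the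
one-loop coefficients with the geometric rate `|β⁰_{k+1} − β⁰_∞| ≤ (c/(1−θ))·θ^k` — literally the `hconv` input of `FlowStepRuns` §10 /
the field `conv` of `Beta.Assembly.LimitForm`, which row G-an2-4 ((AF-0r), NOT IN PRINT) exists to supply.  So the β⁰-half is NOT
avoidable: any proof of NE4 re-proves (AF-0r)'s conclusion.  Geometric Cauchy (`cauchySeq_of_le_geometric`,
`dist_le_of_le_geometric_of_tendsto`); `β⁰_∞` is the limit. [folklore] -/
theorem conv_of_scaleShiftRate (hγ : 0 < γ) (hθ1 : θ < 1)
    (hC : ∀ k (p : Fin (k + 1) → ℝ), p ∈ Box γ k → |S.β1 k p| ≤ C * p (Fin.last k))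
    (h : ScaleShiftRate c θ γ β) :
    ∃ binf : ℝ, ∀ k, |S.β0 k - binf| ≤ c / (1 - θ) * θ ^ k := by
  have hstep : ∀ n, dist (S.β0 n) (S.β0 (n + 1)) ≤ c * θ ^ n := fun n => by
    rw [Real.dist_eq, abs_sub_comm]
    exact abs_beta0_step_le_of_scaleShiftRate S hγ hC h n
  obtain ⟨binf, hlim⟩ := cauchySeq_tendsto_of_complete (cauchySeq_of_le_geometric θ c hθ1 hstep)
  refine ⟨binf, fun k => ?_⟩
  have hk := dist_le_of_le_geometric_of_tendsto θ c hθ1 hstep hlim k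
  rw [Real.dist_eq] at hk
  calc |S.β0 k - binf| ≤ c * θ ^ k / (1 - θ) := hk
    _ = c / (1 - θ) * θ ^ k := by ring

/-- **NE4 ⟹ (AF-0r) ∧ β¹-rate.**  Under the corner bound, `ScaleShiftRate c θ γ β` (`0 ≤ θ < 1`) splits into the β⁰-half
`|β⁰_{k+1} − β⁰_∞| ≤ (c/(1−θ))θ^k` AND the β¹-half `RemainderShiftRate S (c + 2c/(1−θ)) θ γ` (the latter by the tree's
`T4BetaMemorySharp.remainderShiftRate_of_scaleShiftRate`). [folklore] -/
theorem split_of_scaleShiftRate (hγ : 0 < γ) (hθ0 : 0 ≤ θ) (hθ1 : θ < 1)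
    (hC : ∀ k (p : Fin (k + 1) → ℝ), p ∈ Box γ k → |S.β1 k p| ≤ C * p (Fin.last k))
    (h : ScaleShiftRate c θ γ β) :
    ∃ binf : ℝ, (∀ k, |S.β0 k - binf| ≤ c / (1 - θ) * θ ^ k) ∧
      RemainderShiftRate S (c + 2 * (c / (1 - θ))) θ γ := by
  obtain ⟨binf, hconv⟩ := conv_of_scaleShiftRate S hγ hθ1 hC h
  have hc₀ : 0 ≤ c / (1 - θ) := div_nonneg (scaleShiftRate_const_nonneg h hγ) (by linarith)
  exact ⟨binf, hconv, T4BetaMemorySharp.remainderShiftRate_of_scaleShiftRate S hθ0 hθ1.le hc₀ hconv h⟩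

/-- **THE SQUARE CLOSES: NE4 ⟺ (AF-0r) ∧ β¹-rate** (at a fixed rate `θ ∈ [0,1[`, under the corner bound, constants existentially
quantified).  `⟸` is the tree's `T4CouplingMatching.scaleShiftRate_of_split`; `⟹` is `split_of_scaleShiftRate`.  Row NE4 is therefore
EXACTLY «(AF-0r) (= GAPS G-an2-4) + the remainder's η-rate (= NE5 on the β-carrier through the read-out (R))», nothing more and
nothing less. [folklore] -/
theorem scaleShiftRate_iff_split (hγ : 0 < γ) (hθ0 : 0 ≤ θ) (hθ1 : θ < 1)
    (hC : ∀ k (p : Fin (k + 1) → ℝ), p ∈ Box γ k → |S.β1 k p| ≤ C * p (Fin.last k)) :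
    (∃ c, ScaleShiftRate c θ γ β) ↔
      (∃ binf c₀ : ℝ, 0 ≤ c₀ ∧ ∀ k, |S.β0 k - binf| ≤ c₀ * θ ^ k) ∧ (∃ c₁, RemainderShiftRate S c₁ θ γ) := by
  constructor
  · rintro ⟨c, h⟩
    obtain ⟨binf, hconv, hrem⟩ := split_of_scaleShiftRate S hγ hθ0 hθ1 hC h
    exact ⟨⟨binf, c / (1 - θ), div_nonneg (scaleShiftRate_const_nonneg h hγ) (by linarith), hconv⟩, ⟨_, hrem⟩⟩
  · rintro ⟨⟨binf, c₀, hc₀, hconv⟩, ⟨c₁, hrem⟩⟩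
    exact ⟨_, scaleShiftRate_of_split S hθ0 hθ1.le hc₀ hconv hrem⟩

end Corner

/-! ## §3 The same two facts ON THE DATA (`NE4OnData D c θ γ := ScaleShiftRate c θ γ D.βfun`, `Spine/NE4/Targets`) -/

section Data

universe u

variable {F : T4Family} {G : Type u} [GaugeGroup G] [MeasurableSpace G] [HaarData G]

/-- [face] Finite-scale vacuity for Bałaban's data `D`: NE4 ON THE DATA from some scale on + the printed-type uniform bound on
`D.βfun` ⟹ `NE4OnData D` with the constant `max c (2B/θ^{k₀})`. [folklore] -/
theorem ne4OnData_of_eventually (D : FiniteEpsData F G) {B γ θ c : ℝ}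
    (hB : ∀ k (v : Fin (k + 1) → ℝ), v ∈ Box γ k → |D.βfun k v| ≤ B) (hθ0 : 0 < θ) (hθ1 : θ ≤ 1) {k₀ : ℕ}
    (hev : ∀ k, k₀ ≤ k → ∀ w : Fin (k + 2) → ℝ, w ∈ Box γ (k + 1) →
      |D.βfun (k + 1) w - D.βfun k (Fin.tail w)| ≤ c * θ ^ k) :
    NE4OnData D (max c (2 * B / θ ^ k₀)) θ γ :=
  scaleShiftRate_of_eventually hB hθ0 hθ1 hev

/-- [face] NE4 ON THE DATA ⟹ (AF-0r) for the data's one-loop coefficients: for any printed one-loop split `S` of `D.βfun` with the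
corner bound, `NE4OnData D c θ γ` (`θ < 1`) gives `β⁰_∞` with `|S.β0 k − β⁰_∞| ≤ (c/(1−θ))·θ^k`. [folklore] -/
theorem conv_of_ne4OnData (D : FiniteEpsData F G) (S : B12Beta.OneLoopSplit D.βfun) {C c γ θ : ℝ}
    (hγ : 0 < γ) (hθ1 : θ < 1)
    (hC : ∀ k (p : Fin (k + 1) → ℝ), p ∈ Box γ k → |S.β1 k p| ≤ C * p (Fin.last k))
    (h : NE4OnData D c θ γ) :
    ∃ binf : ℝ, ∀ k, |S.β0 k - binf| ≤ c / (1 - θ) * θ ^ k :=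
  conv_of_scaleShiftRate S hγ hθ1 hC h

end Data

end Summit.QuantumFields.BalabanUV.T4Continuum.Spine.NE4
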